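import Summits.MatrixMultiplication.OmegaCensus.STPP222CubeValid

/-!
# ω-census, the pattern `(2,2,2)³`: reflection III — mask clearance, kernel-decided validity, the descent

HONEST FRAMING (pub-omega census; verbatim): lottery ticket; floor = certified bounds/negative ranges.
Census STRUCTURE bookkeeping (question Q7, row `k = 3`: the lower half `n₃ ≥ 32`), not progress on `ω`.

Third reflection file: the normalisation / ordering hypotheses `Hyps` clear the exclusions (`excl_clear`), a valid
level's mask is cleared by the genuine value (`linMask_clear`, `maskAt_clear`), the thirteen levels ARE valid
(`valid0 … valid12`, `decide +kernel`), the descent `lvFrom_false`, and the REFLECTION THEOREM `nf_false_of_searchB3`: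
a `true` search refutes every normal-form configuration whose start triple and `q₁`-code it covers.  This is the only
trust point of the per-group kernel theorems `STPP222CubeNone*.lean` (assembled through `STPP222CubeCover.lean`).

References: H. Cohn, R. Kleinberg, B. Szegedy, C. Umans, FOCS 2005 (arXiv:math/0511460), Def. 5.1.
Record: pub-omega HOME `pub-omega-eng2/results/c4red/K2-THRESHOLD-eng2.md` §NEG3 (ENG2 gen 18, 2026-08-23).
-/

open Literature.Computability.AlgebraicComplexity Finset

namespace Summit.MatrixMultiplication.OmegaCensus

namespace STPP222CubeNeg

/-! ## 5. The genuine branch clears every mask -/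

/-- The NORMALISATION / ORDERING hypotheses on a genuine configuration (the symmetry breaking of the search): nonzero
second elements, the two elements of `B t`, `C t` (`t = 1,2`) in increasing code order, and triple 2 not below
triple 1 (`code q₁ ≤ code q₂`, and `code q'₁ ≤ code q'₂` on a tie). -/
structure Hyps {G : Type} [AddCommGroup G] (E : Enc3 G) (val : V13 → G) : Prop where
  /-- `a₀ ≠ 0` -/ a0 : val .a0 ≠ 0
  /-- `a₁ ≠ 0` -/ a1 : val .a1 ≠ 0
  /-- `a₂ ≠ 0` -/ a2 : val .a2 ≠ 0
  /-- `b₀ ≠ 0` -/ b0 : val .b0 ≠ 0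
  /-- `c₀ ≠ 0` -/ c0 : val .c0 ≠ 0
  /-- `B 1` ordered -/ q1 : E.enc (val .q1) < E.enc (val .q1')
  /-- `C 1` ordered -/ r1 : E.enc (val .r1) < E.enc (val .r1')
  /-- `B 2` ordered -/ q2 : E.enc (val .q2) < E.enc (val .q2')
  /-- `C 2` ordered -/ r2 : E.enc (val .r2) < E.enc (val .r2')
  /-- triples 1, 2 ordered -/ lex1 : E.enc (val .q1) ≤ E.enc (val .q2)
  /-- triples 1, 2 ordered (tie) -/ lex2 : E.enc (val .q2) = E.enc (val .q1) → E.enc (val .q1') ≤ E.enc (val .q2')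

/-- Nonzero elements have nonzero codes. -/
theorem enc_ne_zero {G : Type} [AddCommGroup G] (E : Enc3 G) {g : G} (h : g ≠ 0) : E.enc g ≠ 0 :=
  fun e => h (E.enc_inj (e.trans E.enc_zero.symm))

/-- Bits of `lowMask k` are the positions `< k`. -/
theorem lt_of_testBit_lowMask {k x : ℕ} (h : (lowMask k).testBit x = true) : x < k := by
  change (1 <<< k - 1).testBit x = true at h
  rw [Nat.one_shiftLeft, Nat.testBit_two_pow_sub_one] at h
  exact decide_eq_true_iff.1 h

/-- The only bit of `1` is position `0`. -/
theorem testBit_one_of_ne_zero {x : ℕ} (h : x ≠ 0) : (1 : ℕ).testBit x = false := by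
  have e : (1 : ℕ) = 2 ^ 0 := rfl
  rw [e, Nat.testBit_two_pow]
  exact decide_eq_false fun h0 => h h0.symm

/-- Agreement is monotone in the position. -/
theorem agrees_mono {G : Type} [AddCommGroup G] (E : Enc3 G) (val : V13 → G) {P : Cfg3} {p q : ℕ}
    (h : Agrees E val P p) (hqp : q ≤ p) : Agrees E val P q := fun u hu => h u (lt_of_lt_of_le hu hqp)

/-- EXCLUSIONS are cleared by the genuine value of the position. -/
theorem excl_clear {G : Type} [AddCommGroup G] (E : Enc3 G) {val : V13 → G} (hH : Hyps E val) {P : Cfg3} {v : V13}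
    (hag : Agrees E val P v.idx) : (excl P v).testBit (E.enc (val v)) = false := by
  cases v
  case a0 | b0 | c0 | q1 | r1 | r2 => exact Nat.zero_testBit _
  case a1 => exact testBit_one_of_ne_zero (enc_ne_zero E hH.a1)
  case a2 => exact testBit_one_of_ne_zero (enc_ne_zero E hH.a2)
  case q1' =>
    have e : P.q1 = E.enc (val .q1) := hag .q1 (by decide)
    by_contra h
    rw [Bool.not_eq_false] at h
    have := lt_of_testBit_lowMask h
    have := hH.q1; omega
  case r1' =>
    have e : P.r1 = E.enc (val .r1) := hag .r1 (by decide)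
    by_contra h
    rw [Bool.not_eq_false] at h
    have := lt_of_testBit_lowMask h
    have := hH.r1; omega
  case q2 =>
    have e : P.q1 = E.enc (val .q1) := hag .q1 (by decide)
    by_contra h
    rw [Bool.not_eq_false] at h
    have := lt_of_testBit_lowMask h
    have := hH.lex1; omega
  case r2' =>
    have e : P.r2 = E.enc (val .r2) := hag .r2 (by decide)
    by_contra h
    rw [Bool.not_eq_false] at h
    have := lt_of_testBit_lowMask h
    have := hH.r2; omega
  case q2' =>
    have e1 : P.q1 = E.enc (val .q1) := hag .q1 (by decide)
    have e2 : P.q2 = E.enc (val .q2) := hag .q2 (by decide)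
    have e3 : P.q1' = E.enc (val .q1') := hag .q1' (by decide)
    by_contra h
    rw [Bool.not_eq_false] at h
    change (lowMask (P.q2 + 1) ||| (bif P.q2 == P.q1 then lowMask P.q1' else 0)).testBit _ = true at h
    rw [Nat.testBit_lor, Bool.or_eq_true] at h
    rcases h with h | h
    · have := lt_of_testBit_lowMask h
      have := hH.q2; omega
    · by_cases hq : P.q2 = P.q1
      · rw [show (P.q2 == P.q1) = true from beq_iff_eq.2 hq, cond_true] at h
        have := lt_of_testBit_lowMask h
        have := hH.lex2 (by rw [← e1, ← e2, hq]); omega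
      · rw [show (P.q2 == P.q1) = false from beq_eq_false_iff_ne.2 hq, cond_false] at h
        exact absurd h (by simp)

/-- MASK CLEARANCE: at a valid position, on an agreeing configuration, the genuine value's bit is clear (given it is
clear in the base mask). [cite: CohnKleinbergSzegedyUmans2005, Def. 5.1] -/
theorem linMask_clear {G : Type} [AddCommGroup G] (E : Enc3 G) {SA SB SC : Fin 3 → Finset G} (hS : IsSTPP SA SB SC)
    {val : V13 → G} (hN : NF SA SB SC val) {p : ℕ} {v : V13} {L : List Idx3} {K : List LinCl}
    (hv : allV[p]? = some v) (hLK : levelValid p L K = true) {P : Cfg3} (hag : Agrees E val P p) {m₀ : ℕ}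
    (hm : m₀.testBit (E.enc (val v)) = false) : (linMask E.A P K m₀).testBit (E.enc (val v)) = false := by
  by_contra h
  rw [Bool.not_eq_false] at h
  rcases of_testBit_linMask _ _ _ _ _ h with h | ⟨l, hl, he⟩
  · rw [hm] at h; exact Bool.false_ne_true h
  obtain ⟨ι, hval⟩ := exists_valid_of_mem hLK hl
  have hw := gword_of_valid hval hv val
  have hv' := hval
  simp only [linValid, hv, Bool.and_eq_true, Bool.not_eq_true', beq_iff_eq, List.all_eq_true, decide_eq_true_eq]
    at hv'
  obtain ⟨⟨⟨⟨⟨⟨hconcl, _⟩, _⟩, hlt⟩, hnm⟩, hp6⟩, hm6⟩ := hv'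
  have hvp := idx_of_getElem? hv
  have hag' : ∀ u ∈ l.plus ++ l.minus, P.get u = E.enc (val u) :=
    fun u hu => hag u (by have := hlt u hu; omega)
  rw [linForb_eq E val hag' hnm hp6 hm6] at he
  have hvv := E.enc_inj he
  apply gword_ne_zero hS hN ι hconcl
  rw [hw, ← hvv]
  cases l.pos <;> simp [sgv]

/-- Mask clearance with the exclusions as base mask. -/
theorem maskAt_clear {G : Type} [AddCommGroup G] (E : Enc3 G) {SA SB SC : Fin 3 → Finset G} (hS : IsSTPP SA SB SC)
    {val : V13 → G} (hN : NF SA SB SC val) (hH : Hyps E val) {p : ℕ} {v : V13} {L : List Idx3} {K : List LinCl}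
    (hv : allV[p]? = some v) (hLK : levelValid p L K = true) {P : Cfg3} (hag : Agrees E val P p) :
    (maskAt E.A K v P).testBit (E.enc (val v)) = false :=
  linMask_clear E hS hN hv hLK hag (excl_clear E hH (by rw [idx_of_getElem? hv]; exact hag))

/-! ## 6. Validity of the thirteen levels (decided in the kernel) -/

/-- Position 0. -/ theorem valid0 : levelValid 0 L0 K0 = true := by decide +kernel
/-- Position 1. -/ theorem valid1 : levelValid 1 L1 K1 = true := by decide +kernel
/-- Position 2. -/ theorem valid2 : levelValid 2 L2 K2 = true := by decide +kernel
/-- Position 3. -/ theorem valid3 : levelValid 3 L3 K3 = true := by decide +kernel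
/-- Position 4. -/ theorem valid4 : levelValid 4 L4 K4 = true := by decide +kernel
/-- Position 5. -/ theorem valid5 : levelValid 5 L5 K5 = true := by decide +kernel
/-- Position 6. -/ theorem valid6 : levelValid 6 L6 K6 = true := by decide +kernel
/-- Position 7. -/ theorem valid7 : levelValid 7 L7 K7 = true := by decide +kernel
/-- Position 8. -/ theorem valid8 : levelValid 8 L8 K8 = true := by decide +kernel
/-- Position 9. -/ theorem valid9 : levelValid 9 L9 K9 = true := by decide +kernel
/-- Position 10. -/ theorem valid10 : levelValid 10 L10 K10 = true := by decide +kernel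
/-- Position 11. -/ theorem valid11 : levelValid 11 L11 K11 = true := by decide +kernel
/-- Position 12. -/ theorem valid12 : levelValid 12 L12 K12 = true := by decide +kernel

/-! ## 7. The descent -/

/-- `allB` is `List.all`. -/
theorem allB_eq (l : List ℕ) (m : ℕ) (cont : ℕ → Bool) : allB l m cont = l.all fun x => m.testBit x || cont x := by
  induction l with
  | nil => rfl
  | cons x l ih => exact congrArg (fun b => (m.testBit x || cont x) && b) ih

/-- A `true` level with a clear bit forces the continuation. -/
theorem stepB_true {el : List ℕ} {m : ℕ} {cont : ℕ → Bool} (h : stepB el m cont = true) {x : ℕ} (hx : x ∈ el)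
    (hb : m.testBit x = false) : cont x = true := by
  rw [stepB, force_eq, allB_eq, List.all_eq_true] at h
  have := h x hx
  rw [hb, Bool.false_or] at this
  exact this

/-- A CHAIN of levels from position `p`: consecutive positions, each with a valid clause list. -/
def Chain : ℕ → List (List LinCl × V13) → Prop
  | _, [] => True
  | p, (K, v) :: rest => allV[p]? = some v ∧ (∃ L, levelValid p L K = true) ∧ Chain (p + 1) rest

/-- `LEVELS` is a chain from position 4. -/
theorem chain_LEVELS : Chain 4 LEVELS :=
  ⟨rfl, ⟨L4, valid4⟩, rfl, ⟨L5, valid5⟩, rfl, ⟨L6, valid6⟩, rfl, ⟨L7, valid7⟩, rfl, ⟨L8, valid8⟩, rfl, ⟨L9, valid9⟩,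
    rfl, ⟨L10, valid10⟩, rfl, ⟨L11, valid11⟩, rfl, ⟨L12, valid12⟩, trivial⟩

/-- DESCENT: below an agreeing configuration, the search through a chain of valid levels cannot return `true`. -/
theorem lvFrom_false {G : Type} [AddCommGroup G] (E : Enc3 G) {el : List ℕ} (hel : ∀ g : G, E.enc g ∈ el)
    {SA SB SC : Fin 3 → Finset G} (hS : IsSTPP SA SB SC) {val : V13 → G} (hN : NF SA SB SC val) (hH : Hyps E val) :
    ∀ (Ls : List (List LinCl × V13)) (p : ℕ), Chain p Ls → ∀ P : Cfg3, Agrees E val P p → lvFrom E.A el Ls P = false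
  | [], _, _, _, _ => rfl
  | (K, v) :: rest, p, ⟨hv, ⟨_, hLK⟩, hrest⟩, P, hag => by
    by_contra h
    rw [Bool.not_eq_false] at h
    have hstep : lvFrom E.A el ((K, v) :: rest) P =
        stepB el (maskAt E.A K v P) (fun x => lvFrom E.A el rest (P.set v x)) := rfl
    rw [hstep] at h
    have h' := stepB_true h (hel (val v)) (maskAt_clear E hS hN hH hv hLK hag)
    rw [lvFrom_false E hel hS hN hH rest (p + 1) hrest _ (agrees_set E val hag (idx_of_getElem? hv))] at h'
    exact Bool.false_ne_true h'

/-- `startBad` unfolds. -/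
theorem startBad_eq (A : Arith) (P : Cfg3) : startBad A P =
    ((linMask A P K0 1).testBit P.a0 || (linMask A P K1 1).testBit P.b0 || (linMask A P K2 1).testBit P.c0) := rfl

/-- A `true` search holds for every start of the list. -/
theorem searchB3_mem {A : Arith} {el : List ℕ} {reps : List (ℕ × ℕ × ℕ × List ℕ)} (hs : searchB3 A el reps = true)
    {s : ℕ × ℕ × ℕ × List ℕ} (hmem : s ∈ reps) :
    (startBad A (startCfg s.1 s.2.1 s.2.2.1) || lv3 A el (startCfg s.1 s.2.1 s.2.2.1) s.2.2.2) = true := by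
  induction reps with
  | nil => simp at hmem
  | cons s' R ih =>
    rw [searchB3_cons, Bool.and_eq_true] at hs
    rcases List.mem_cons.1 hmem with rfl | hmem
    · exact hs.1
    · exact ih hs.2 hmem

/-- REFLECTION THEOREM.  If the kernel search over the start list `reps` returns `true`, there is no STPP family over
`G` with a normal-form configuration (membership form `NF`, normalisation / ordering hypotheses `Hyps`) whose encoded
start triple `(a₀, b₀, c₀)` together with the code of `q₁` is covered by `reps`.
[cite: CohnKleinbergSzegedyUmans2005, Def. 5.1] -/
theorem nf_false_of_searchB3 {G : Type} [AddCommGroup G] (E : Enc3 G) {el : List ℕ} (hel : ∀ g : G, E.enc g ∈ el)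
    {reps : List (ℕ × ℕ × ℕ × List ℕ)} (hs : searchB3 E.A el reps = true) {SA SB SC : Fin 3 → Finset G}
    (hS : IsSTPP SA SB SC) {val : V13 → G} (hN : NF SA SB SC val) (hH : Hyps E val) {qs : List ℕ}
    (hrep : (E.enc (val .a0), E.enc (val .b0), E.enc (val .c0), qs) ∈ reps) (hq : E.enc (val .q1) ∈ qs) : False := by
  have h := searchB3_mem hs hrep
  simp only at h
  have hag3 : Agrees E val (startCfg (E.enc (val .a0)) (E.enc (val .b0)) (E.enc (val .c0))) 3 := by
    intro u hu
    cases u <;> first | rfl | exact absurd hu (by decide)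
  have hsb : startBad E.A (startCfg (E.enc (val .a0)) (E.enc (val .b0)) (E.enc (val .c0))) = false := by
    rw [startBad_eq, show (startCfg (E.enc (val .a0)) (E.enc (val .b0)) (E.enc (val .c0))).a0 = E.enc (val .a0)
      from rfl, show (startCfg (E.enc (val .a0)) (E.enc (val .b0)) (E.enc (val .c0))).b0 = E.enc (val .b0) from rfl,
      show (startCfg (E.enc (val .a0)) (E.enc (val .b0)) (E.enc (val .c0))).c0 = E.enc (val .c0) from rfl]
    rw [linMask_clear E hS hN (p := 0) (v := .a0) rfl valid0 (agrees_mono E val hag3 (by omega))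
        (testBit_one_of_ne_zero (enc_ne_zero E hH.a0)),
      linMask_clear E hS hN (p := 1) (v := .b0) rfl valid1 (agrees_mono E val hag3 (by omega))
        (testBit_one_of_ne_zero (enc_ne_zero E hH.b0)),
      linMask_clear E hS hN (p := 2) (v := .c0) rfl valid2 (agrees_mono E val hag3 (by omega))
        (testBit_one_of_ne_zero (enc_ne_zero E hH.c0))]
    rfl
  rw [hsb, Bool.false_or] at h
  have h4 := stepB_true h hq (maskAt_clear E hS hN hH (p := 3) (v := .q1) rfl valid3 hag3)
  rw [lvFrom_false E hel hS hN hH LEVELS 4 chain_LEVELS _ (agrees_set E val hag3 rfl)] at h4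
  exact Bool.false_ne_true h4


end STPP222CubeNeg

end Summit.MatrixMultiplication.OmegaCensus
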